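import Summits.BirchSwinnertonDyer.BirchSwinnertonDyer.Theorems.GenusKolyvaginAtTwoK4NegPhantomCellDescentBitCore
import Summits.BirchSwinnertonDyer.BirchSwinnertonDyer.Theorems.GenusKolyvaginAtTwoK4NegPhantomCellDescentBitSupply
import Summits.BirchSwinnertonDyer.BirchSwinnertonDyer.Theorems.GenusKolyvaginAtTwoOffCutResidualAtTwoRLw2PhantomExclusionKLW
import Summits.BirchSwinnertonDyer.BirchSwinnertonDyer.Theorems.GenusKolyvaginAtTwoGenusDeepSupplyAtTwoNegDiscNarrowDepthZeroRationalTorsion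
import Literature.NumberTheory.EllipticCurves.HeegnerPointsKolyvaginConjugation
import Literature.NumberTheory.EllipticCurves.KummerMap
import HarnessLib

/-!
# Route `GenusKolyvaginAtTwo`, crux K₄⁻ `K4Neg` (stmt-BirchSwinnertonDyer-31526), the phantom cell F4ᵖᵍ — THE HEEGNER DESCENT BIT,
# part 3: `hDesc` HOLDS ON EVERY (α)-FRAME — the LEAD's descent hypothesis discharged where the Lawson–Wuthrich class is alive at `ℓ₀`

Seat `bsd-line-gk2-p3` g34 (PROVER seat 3/3, cell `bsd-f1-sign2`), `--supports stmt-BirchSwinnertonDyer-31526 --as helper`.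
THEOREMS ONLY (no definition, no named fact, no `sorry`); standard axioms; UNCONDITIONAL.  **BSD is NOT proved by this file; K4Neg
is NOT proved; nothing is closed.**

WHAT.  LEAD gk2-p1 g28's `PlusDescent.kFourNeg_shape_of_topBits` (p786172) gives the K4Neg CONCLUSION SHAPE on the phantom cell modulo
Q2, one sharp Selmer class with good top bits (his supply), and the HEEGNER DESCENT BIT
  `hDesc : ∀ (b : ℤ) (Q : E(K̄)), (∀ ρ ∈ Γ_{K(E[2^L])}, ρ • Q = Q) → 2^M • Q = ι(b • y_K) → ∃ R ∈ E(K), 2^M • R = b • y_K`.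
This file PROVES `hDesc` (for EVERY point of `E(K)`, every `M ≤ L`, `L ≥ 2`) on every prime frame `ℓ₀ ∣ d_K` (odd, good reduction) AT WHICH
THE LEVEL-2 LAWSON–WUTHRICH CLASS `ξ_E` IS ALIVE, in the Galois currency supplied by part 1 (an arithmetic Frobenius `F` over `ℓ₀` with
`F·F ∈ Γ_{ℚ(E[2])}`, `[ξ_E, F·F] ≠ 0`; such frames exist beyond every bound), under the cell's hypotheses `ρ_{E,2^n}` onto, `d_K` odd, the two
Theorem-B₂ non-squares, and «every `Aut(K/ℚ)`-fixed point of `E(K)` is odd torsion» (= `rank E(ℚ) = 0`, `E(K)[2] = 0`; §5).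

HOW.  (§2) Unfolding the `K`-side class equality `κ^K(Q) = res_K ξ` through `θ : E(ℚ̄) ≃ E_K(K̄)` (`RatClosure.pointsEquiv`) gives exactly
the hypothesis of part 2's core `false_of_antiInvariant_kummer_eq_h1Eval`: NO ANTI-invariant `A ∈ E(K)` has `κ^K(A) = res_K ξ`.  (§3) For any
`P ∈ E(K)`: `R = P + τP` is `Aut`-fixed, so `m • R = 0` with `m` odd; `A = m • P` is anti-invariant, `κ(A) = m·κ(P)` and `m·res ξ = res ξ`.  (§4)
Induction on `M`: the Kummer class of `Q₁ = 2^M Q` dies on `Γ_{K(E[2^L])}`, hence is `0` or `res_K ξ` (Lawson–Wuthrich over `K`, gk2-p4 g31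
`eq_zero_or_eq_resTorsion_of_forall_torsionFixing_pow`); `res_K ξ` is excluded by §3; so `Q₁ = ι R₁ + T`, `T ∈ E[2]`, `2R₁ = P`; with
`T' ∈ E[2^(M+1)] ⊆ E[2^L]`, `2^M T' = T`, the point `Q − T'` is `Γ_L`-fixed with `2^M (Q − T') = ι R₁`, and induction gives `2^(M+1) R = P`.

HONEST RESIDUAL.  On the complementary (β)-frames (`loc_{ℓ₀} ξ_E = 0`: the twin's Selmer generator IS the phantom) `hDesc` fails as stated;
part 1 shows (α)-frames exist beyond every bound (enough for the `∃`-parent 23491), while the `∀`-item K4Neg keeps the (β)-frames as residual.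

References: [LawsonWuthrich2016] §3, §7.1; [GrossLMS1991] §9; [SilvermanAEC2009] VIII.§1–§2, VII.3.1(b); [SerreGaloisCohomology1997] I.§2.4.
-/

set_option linter.dupNamespace false -- tree convention: `Summit.BirchSwinnertonDyer.BirchSwinnertonDyer.Theorems` (summit = sub-problem)
set_option autoImplicit false

noncomputable section

open scoped Classical NumberField Pointwise

namespace Summit.BirchSwinnertonDyer.BirchSwinnertonDyer.Theorems.GenusExact.PhantomDescentBit

open WeierstrassCurve NumberField IsDedekindDomain Field
open Literature.NumberTheory.GaloisRepresentations Literature.NumberTheory.EllipticCurves Rat.HeightOneSpectrum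
open Summit.BirchSwinnertonDyer.BirchSwinnertonDyer.Theorems.GenusSupplyNarrow.DepthZero
open Summit.BirchSwinnertonDyer.BirchSwinnertonDyer.Theorems.GenusExact.Lw2PhantomExclusion
open Summit.BirchSwinnertonDyer.BirchSwinnertonDyer.Theorems.GenusKolyTwistingPrime
open Summit.BirchSwinnertonDyer.BirchSwinnertonDyer.Theorems.KolyvaginLowerBoundAtTwo (torsionFixing_le_of_dvd)

/-! ## §1 The dictionary `θ = RatClosure.pointsEquiv : E(ℚ̄) ≃ E_K(K̄)` -/
section Dictionary

variable (W : WeierstrassCurve ℚ) {K : Type} [Field K] [NumberField K]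

/-- `θ ∘ e_* = ι`: `θ (e_* X) = toGeomPoints X` for `X ∈ E(K)` (`absClosureEmbedding ∘ absEmbedding = algebraMap K K̄`). [folklore] -/
theorem pointsEquiv_map_absEmbedding_eq_toGeomPoints (X : (W.baseChange K).toAffine.Point) :
    RatClosure.pointsEquiv (K := K) W (Affine.Point.map (W' := W) (absEmbedding ℚ K) X) = toGeomPoints (W.baseChange K) X := by
  rcases X with _ | ⟨x, y, h⟩
  · rfl
  · exact Affine.Point.some_eq_some_of_eq (absClosureEmbedding_absEmbedding ℚ K x) (absClosureEmbedding_absEmbedding ℚ K y)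

/-- The coefficient map of `resTorsion W K n` on points IS `θ` (both apply the chosen `ℚ̄ → K̄` to the coordinates). [folklore] -/
theorem coe_torsionBaseChangeMap_eq_pointsEquiv (n : ℤ) (t : geomTorsion W n) :
    (torsionBaseChangeMap W K n t : geomPoints (W.baseChange K)) = RatClosure.pointsEquiv (K := K) W (t : W.geomPoints) := by
  rw [coe_torsionBaseChangeMap]
  generalize (t : W.geomPoints) = P
  change (W.baseChange (AlgebraicClosure ℚ)).toAffine.Point at P
  rcases P with _ | ⟨x, y, h⟩
  · exact (map_zero _).trans (map_zero _).symm
  · rfl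

/-- `θ⁻¹ (σ • Y) = res σ • θ⁻¹ Y` (`θ` is equivariant along the embedded `Γ_K`, `RatClosure.pointsEquiv_smul`). [folklore] -/
theorem pointsEquiv_symm_smul (σ : absoluteGaloisGroup K) (Y : geomPoints (W.baseChange K)) :
    (RatClosure.pointsEquiv (K := K) W).symm (σ • Y) = absGaloisRestrict ℚ K σ • (RatClosure.pointsEquiv (K := K) W).symm Y := by
  apply (RatClosure.pointsEquiv (K := K) W).injective
  rw [AddEquiv.apply_symm_apply, RatClosure.pointsEquiv_smul, AddEquiv.apply_symm_apply]

/-- `2 • c = 0` for every `c ∈ H¹(F, E[2])` (the coefficients are `2`-torsion). [folklore] -/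
theorem two_nsmul_galH1Torsion_two {F : Type} [Field F] (V : WeierstrassCurve F) (c : galH1Torsion V (2 : ℤ)) : 2 • c = 0 := by
  obtain ⟨φ, rfl⟩ := oneCocycleClass_surjective _ c
  exact nsmul_oneCocycleClass_eq_zero _ _ fun σ ↦ AddSubgroup.torsionBy.nsmul (φ.1 σ)

/-- An ODD multiple of a class of `H¹(F, E[2])` is the class. [folklore] -/
theorem odd_zsmul_galH1Torsion_two {F : Type} [Field F] (V : WeierstrassCurve F) (c : galH1Torsion V (2 : ℤ)) {m : ℕ} (hm : Odd m) :
    (m : ℤ) • c = c := by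
  obtain ⟨k, rfl⟩ := hm
  rw [natCast_zsmul, add_nsmul, one_nsmul, mul_nsmul', two_nsmul_galH1Torsion_two, zero_add]

end Dictionary

/-! ## §2 No anti-invariant point of `E(K)` has `K`-Kummer class `res_K ξ` (the core, `K`-currency) -/
section Frame

variable (W : WeierstrassCurve ℚ) [W.IsElliptic] [W.IsGloballyMinimal] {K : Type} [Field K] [NumberField K]

/-- **NO ANTI-INVARIANT `A ∈ E(K)` HAS `κ^K(A) = res_K ξ` ON AN (α)-FRAME.**  `E = W/ℚ` globally minimal; `K` quadratic with an odd prime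
`ℓ₀ ∣ d_K` of good reduction; `E(ℚ)[2] = 0` in the form «`ρ̄_{E,2}` onto»; `ξ ∈ H¹(ℚ, E[2])` dying on `Γ_{ℚ(E[4])}`; the (α)-datum: an arithmetic
Frobenius `F` at SOME prime `𝔓₀ ∣ ℓ₀` of `\bar ℤ` with `F·F ∈ Γ_{ℚ(E[2])}`, `[ξ, F·F] ≠ 0`.  Then for `A ∈ E(K)` with `τA = −A` (all `τ ≠ 1`) and any
`Q ∈ E_K(K̄)` with `2Q = ι A`: **the Kummer class of `Q` in `H¹(K, E[2])` is NOT `res_K ξ`.**  Proof: move `F` to the place's prime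
(`exists_isArithFrobAt_conj_of_mem_primesAbove_holds`, `[ξ, δF²δ⁻¹] = δ[ξ,F²]`), unfold the class equality to cocycles modulo a coboundary, transport
along `θ⁻¹` (§1) to `E(ℚ̄)`, and apply part 2's `false_of_antiInvariant_kummer_eq_h1Eval`.
[cite: LawsonWuthrich2016, §7.1] [cite: SilvermanAEC2009, VIII.§2] [cite: SerreGaloisCohomology1997, I.§2.4] -/
theorem kummerClassTorsion_ne_resTorsion_of_antiInvariant
    (hsurj : W.HasSurjectiveModNGaloisRep 2) (h2 : Module.finrank ℚ K = 2)
    {ℓ₀ : ℕ} [Fact ℓ₀.Prime] (hℓ2 : ℓ₀ ≠ 2) (hℓK : (ℓ₀ : ℤ) ∣ NumberField.discr K) (hΔ : ¬ (ℓ₀ : ℤ) ∣ minimalDiscriminantInt W)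
    {ξ : galH1Torsion W (2 : ℤ)} (hξ4 : ∀ h ∈ torsionFixing W (4 : ℤ), h1Eval W (2 : ℤ) ξ h = 0)
    {v : HeightOneSpectrum (𝓞 ℚ)} (hv : (primesEquiv v : ℕ) = ℓ₀) {𝔓₀ : Ideal (absIntegers (𝓞 ℚ) ℚ)} (h𝔓₀ : 𝔓₀ ∈ v.primesAbove)
    {F : absoluteGaloisGroup ℚ} (hF : IsArithFrobAt (𝓞 ℚ) F 𝔓₀) (hF2 : F * F ∈ torsionFixing W (2 : ℤ))
    (hval : h1Eval W (2 : ℤ) ξ (F * F) ≠ 0)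
    {A : (W.baseChange K).toAffine.Point} (hA : ∀ τ : K ≃ₐ[ℚ] K, τ ≠ 1 → τ • A = -A)
    (Q : geomPoints (W.baseChange K))
    (hQ : (2 : ℤ) • Q = toGeomPoints (W.baseChange K) A) :
    kummerClassTorsion (W.baseChange K) (2 : ℤ) Q (by rw [hQ]; exact toGeomPoints_mem_fixedPoints _ _) ≠ resTorsion W K (2 : ℤ) ξ := by
  intro heq
  -- ### the place's prime `𝔓` and a Frobenius there
  obtain ⟨𝔓, hmem, h𝔓⟩ := exists_ideal_placeOver (p := ℓ₀) hv
  obtain ⟨δ, -, hFδ⟩ := HeightOneSpectrum.exists_isArithFrobAt_conj_of_mem_primesAbove_holds h𝔓₀ h𝔓 hF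
  have hF2δ : δ * F * δ⁻¹ * (δ * F * δ⁻¹) ∈ torsionFixing W (2 : ℤ) := by
    have : δ * F * δ⁻¹ * (δ * F * δ⁻¹) = δ * (F * F) * δ⁻¹ := by group
    rw [this]
    exact (torsionFixing_normal W _).conj_mem _ hF2 δ
  have hvalδ : h1Eval W (2 : ℤ) ξ (δ * F * δ⁻¹ * (δ * F * δ⁻¹)) ≠ 0 := by
    have : δ * F * δ⁻¹ * (δ * F * δ⁻¹) = δ * (F * F) * δ⁻¹ := by group
    rw [this, h1Eval_conj W _ ξ δ hF2]
    exact fun h ↦ hval ((smul_eq_zero_iff_eq δ).mp h)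
  -- ### no `Γ_ℚ`-fixed non-zero `2`-torsion
  have h2Q : ∀ u : geomTorsion W (2 : ℤ), (∀ ρ : absoluteGaloisGroup ℚ, ρ • u = u) → u = 0 := by
    obtain ⟨z, -, hzfix⟩ := exists_smul_three_rat W hsurj
    exact fun u hu ↦ hzfix u (hu z)
  -- ### unfold the class equality to cocycles modulo a coboundary
  set θ := RatClosure.pointsEquiv (K := K) W with hθ
  have hQmem : (2 : ℤ) • Q ∈ MulAction.fixedPoints (absoluteGaloisGroup K) (geomPoints (W.baseChange K)) := by
    rw [hQ]; exact toGeomPoints_mem_fixedPoints _ _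
  set κ := kummerCocycleTorsion (W.baseChange K) (2 : ℤ) Q hQmem with hκ
  set π := contOneCocycles.pullback (resGal (K := ℚ) K)
    (resHomOfEquivariant (resGal (K := ℚ) K) (torsionBaseChangeMap W K (2 : ℤ)) (torsionBaseChangeMap_smul W K (2 : ℤ)))
    (reprCocycle W (2 : ℤ) ξ) with hπ
  have hres : resTorsion W K (2 : ℤ) ξ = oneCocycleClass _ π := by
    conv_lhs => rw [← oneCocycleClass_reprCocycle W (2 : ℤ) ξ]
    rw [resTorsion, resH1Hom_oneCocycleClass]
  have hκπ : oneCocycleClass _ κ = oneCocycleClass _ π := by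
    rw [← hres]; exact heq
  have h0 : oneCocycleClass _ (κ - π) = 0 := by rw [oneCocycleClass_sub, hκπ, sub_self]
  obtain ⟨w, hw⟩ := (oneCocycleClass_eq_zero_iff _ _).mp h0
  -- values: `(σQ − Q) − θ[ξ, res σ] = σ w − w` in `E_K(K̄)`
  have hπσ : ∀ σ : absoluteGaloisGroup K, ((π.1 σ : geomTorsion (W.baseChange K) (2 : ℤ)) : geomPoints (W.baseChange K)) =
      θ (h1Eval W (2 : ℤ) ξ (resGal (K := ℚ) K σ) : W.geomPoints) := by
    intro σ
    rw [hθ, ← coe_torsionBaseChangeMap_eq_pointsEquiv, hπ, pullback_resHomOfEquivariant_apply]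
    rfl
  have hvalσ : ∀ σ : absoluteGaloisGroup K,
      (σ • Q - Q) - θ (h1Eval W (2 : ℤ) ξ (resGal (K := ℚ) K σ) : W.geomPoints) =
        σ • (w : geomPoints (W.baseChange K)) - w := by
    intro σ
    have h := hw σ
    rw [discreteTopRep_ρ_apply] at h
    have h' := congrArg Subtype.val h
    change (σ • Q - Q) - ((π.1 σ : geomTorsion (W.baseChange K) (2 : ℤ)) : geomPoints (W.baseChange K)) =
      σ • (w : geomPoints (W.baseChange K)) - w at h'
    rw [hπσ σ] at h'
    exact h'
  -- ### transport along `θ⁻¹` to `E(ℚ̄)`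
  set Q₀ : W.geomPoints := θ.symm Q with hQ₀
  set v₀ : W.geomPoints := θ.symm (w : geomPoints (W.baseChange K)) with hv₀
  have hQ₀' : (2 : ℤ) • Q₀ = Affine.Point.map (W' := W) (absEmbedding ℚ K) A := by
    apply θ.injective
    rw [map_zsmul, hQ₀, AddEquiv.apply_symm_apply, hQ, hθ, pointsEquiv_map_absEmbedding_eq_toGeomPoints]
  have hv₀' : (2 : ℤ) • v₀ = 0 := by
    apply θ.injective
    rw [map_zsmul, hv₀, AddEquiv.apply_symm_apply, map_zero]
    exact (mem_geomTorsion_iff _ (2 : ℤ) _).mp w.2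
  have hyp : ∀ ρ ∈ (absGaloisRestrict ℚ K).range,
      ρ • Q₀ - Q₀ = (h1Eval W (2 : ℤ) ξ ρ : W.geomPoints) + (ρ • v₀ - v₀) := by
    rintro ρ ⟨σ, rfl⟩
    have h := congrArg θ.symm (hvalσ σ)
    rw [map_sub, map_sub, map_sub, AddEquiv.symm_apply_apply, pointsEquiv_symm_smul, pointsEquiv_symm_smul, ← hQ₀, ← hv₀] at h
    rw [resGal_eq_absGaloisRestrict] at h
    have key : absGaloisRestrict ℚ K σ • Q₀ - Q₀ =
        (h1Eval W (2 : ℤ) ξ (absGaloisRestrict ℚ K σ) : W.geomPoints) + (absGaloisRestrict ℚ K σ • v₀ - v₀) := by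
      rw [← h]
      abel
    exact key
  exact false_of_antiInvariant_kummer_eq_h1Eval (p := ℓ₀) hΔ hmem hℓ2 hv h𝔓 h2 hℓK h2Q hξ4 hFδ hF2δ hvalδ hA hQ₀' hv₀' hyp

/-! ## §3 … hence NO point of `E(K)` has `K`-Kummer class `res_K ξ` (odd-torsion `Aut`-fixed part) -/
/-- **NO `P ∈ E(K)` HAS `κ^K(P) = res_K ξ` ON AN (α)-FRAME**, provided every `Aut(K/ℚ)`-fixed point of `E(K)` is ODD torsion (on the K₄⁻ cell:
`rank E(ℚ) = 0`, `E(K)[2] = 0`, §5).  Reduction to §2: `R = P + τP` is fixed, so `m • R = 0` with `m` odd; `A = m • P` is anti-invariant with the root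
`m • Q`, and `κ(m • Q) = m·κ(Q) = m·res ξ = res ξ` (`2·res ξ = 0`).  [cite: LawsonWuthrich2016, §7.1] [cite: SilvermanAEC2009, VIII.§2] -/
theorem kummerClassTorsion_ne_resTorsion_of_fixed_odd
    (hsurj : W.HasSurjectiveModNGaloisRep 2) (h2 : Module.finrank ℚ K = 2)
    {ℓ₀ : ℕ} [Fact ℓ₀.Prime] (hℓ2 : ℓ₀ ≠ 2) (hℓK : (ℓ₀ : ℤ) ∣ NumberField.discr K) (hΔ : ¬ (ℓ₀ : ℤ) ∣ minimalDiscriminantInt W)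
    {ξ : galH1Torsion W (2 : ℤ)} (hξ4 : ∀ h ∈ torsionFixing W (4 : ℤ), h1Eval W (2 : ℤ) ξ h = 0)
    {v : HeightOneSpectrum (𝓞 ℚ)} (hv : (primesEquiv v : ℕ) = ℓ₀) {𝔓₀ : Ideal (absIntegers (𝓞 ℚ) ℚ)} (h𝔓₀ : 𝔓₀ ∈ v.primesAbove)
    {F : absoluteGaloisGroup ℚ} (hF : IsArithFrobAt (𝓞 ℚ) F 𝔓₀) (hF2 : F * F ∈ torsionFixing W (2 : ℤ))
    (hval : h1Eval W (2 : ℤ) ξ (F * F) ≠ 0)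
    (hfixodd : ∀ R : (W.baseChange K).toAffine.Point, (∀ τ : K ≃ₐ[ℚ] K, τ • R = R) → ∃ m : ℕ, Odd m ∧ (m : ℤ) • R = 0)
    (P : (W.baseChange K).toAffine.Point) (Q : geomPoints (W.baseChange K))
    (hQ : (2 : ℤ) • Q = toGeomPoints (W.baseChange K) P) :
    kummerClassTorsion (W.baseChange K) (2 : ℤ) Q (by rw [hQ]; exact toGeomPoints_mem_fixedPoints _ _) ≠ resTorsion W K (2 : ℤ) ξ := by
  intro heq
  haveI : Algebra.IsQuadraticExtension ℚ K := ⟨h2⟩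
  haveI : IsGalois ℚ K := inferInstance
  have hcard : Nat.card (K ≃ₐ[ℚ] K) = 2 := by rw [IsGalois.card_aut_eq_finrank, h2]
  -- the non-trivial automorphism `τ`
  obtain ⟨τ, hτ1⟩ : ∃ τ : K ≃ₐ[ℚ] K, τ ≠ 1 := by
    by_contra h
    push Not at h
    haveI : Subsingleton (K ≃ₐ[ℚ] K) := ⟨fun a b ↦ (h a).trans (h b).symm⟩
    have := hcard ▸ Nat.card_of_subsingleton (1 : K ≃ₐ[ℚ] K)
    omega
  have hττ : τ * τ = 1 := by
    rcases Literature.NumberTheory.QuadraticFields.eq_one_or_eq_of_card_eq_two hcard hτ1 (τ * τ) with h | h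
    · exact h
    · exact absurd (mul_left_cancel (a := τ) (h.trans (mul_one τ).symm)) hτ1
  -- `R := P + τP` is `Aut`-fixed, hence `m • R = 0` with `m` odd
  have hRfix : ∀ σ : K ≃ₐ[ℚ] K, σ • (P + τ • P) = P + τ • P := by
    intro σ
    rcases Literature.NumberTheory.QuadraticFields.eq_one_or_eq_of_card_eq_two hcard hτ1 σ with rfl | rfl
    · exact one_smul _ _
    · rw [smul_add, ← mul_smul, hττ, one_smul, add_comm]
  obtain ⟨m, hm, hmR⟩ := hfixodd (P + τ • P) hRfix
  -- `A := m • P` is anti-invariant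
  have hA : ∀ σ : K ≃ₐ[ℚ] K, σ ≠ 1 → σ • ((m : ℤ) • P) = -((m : ℤ) • P) := by
    intro σ hσ
    rcases Literature.NumberTheory.QuadraticFields.eq_one_or_eq_of_card_eq_two hcard hτ1 σ with h1 | hστ
    · exact absurd h1 hσ
    · rw [hστ]
      have hτP : τ • P = -P + (P + τ • P) := by abel
      have hsm : τ • ((m : ℤ) • P) = (m : ℤ) • (τ • P) := map_zsmul (DistribSMul.toAddMonoidHom _ τ) (m : ℤ) P
      rw [hsm, hτP, smul_add, hmR, add_zero, smul_neg]
  -- the root `m • Q` of `ι A` and its Kummer class `m • κ(Q)`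
  have hQm : (2 : ℤ) • ((m : ℤ) • Q) = toGeomPoints (W.baseChange K) ((m : ℤ) • P) := by
    rw [smul_comm, hQ, map_zsmul]
  have hne := kummerClassTorsion_ne_resTorsion_of_antiInvariant W hsurj h2 hℓ2 hℓK hΔ hξ4 hv h𝔓₀ hF hF2 hval hA ((m : ℤ) • Q) hQm
  apply hne
  -- `κ(m • Q) = m • κ(Q)` through the Kummer MAP of `E_K(K)` (any root computes it)
  have hdiv : ∀ X : geomPoints (W.baseChange K), ∃ Y : geomPoints (W.baseChange K), (2 : ℤ) • Y = X :=
    (W.baseChange K).zsmul_geomPoints_surjective_of_charZero two_ne_zero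
  have hκP : kummerMapTorsion (W.baseChange K) (2 : ℤ) hdiv P =
      kummerClassTorsion (W.baseChange K) (2 : ℤ) Q (by rw [hQ]; exact toGeomPoints_mem_fixedPoints _ _) := by
    rw [kummerMapTorsion_apply]
    exact kummerMapTorsionFun_eq (W.baseChange K) (2 : ℤ) hdiv P Q hQ
  have hκA : kummerMapTorsion (W.baseChange K) (2 : ℤ) hdiv ((m : ℤ) • P) =
      kummerClassTorsion (W.baseChange K) (2 : ℤ) ((m : ℤ) • Q) (by rw [hQm]; exact toGeomPoints_mem_fixedPoints _ _) := by
    rw [kummerMapTorsion_apply]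
    exact kummerMapTorsionFun_eq (W.baseChange K) (2 : ℤ) hdiv _ _ hQm
  rw [← hκA, map_zsmul, hκP, heq, ← map_zsmul, odd_zsmul_galH1Torsion_two W ξ hm]

/-! ## §4 The Heegner descent bit `hDesc` on an (α)-frame -/
/-- ★ **`hDesc` FOR EVERY POINT OF `E(K)` ON AN (α)-FRAME.**  Frame: `E = W/ℚ` globally minimal with `ρ_{E,2^n}` onto for all `n ≥ 1`; `K` imaginary
quadratic, `d_K` odd, `d_K·(−|Δ|)` and `d_K·(−2|Δ|)` non-squares (Lawson–Wuthrich rigidity over `K`, gk2-p4 g31); an odd prime `ℓ₀ ∣ d_K` of good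
reduction at which the Lawson–Wuthrich class `ξ` (`ξ ≠ 0`, dying on `Γ_{ℚ(E[4])}`) is ALIVE: an arithmetic Frobenius `F` at a prime `𝔓₀ ∣ ℓ₀` with
`F·F ∈ Γ_{ℚ(E[2])}`, `[ξ, F·F] ≠ 0` (part 1 supplies such frames beyond every bound); every `Aut(K/ℚ)`-fixed point of `E(K)` is odd torsion.
THEN for `2 ≤ L`, `M ≤ L`, every `P ∈ E(K)` and every `Q ∈ E_K(K̄)` FIXED by `Γ_{K(E[2^L])}` with `2^M • Q = ι P`: **`P ∈ 2^M E(K)`**.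
Induction on `M` (module docstring §4).  [cite: LawsonWuthrich2016, §3 (Lemma 6, Thm. 1), §7.1] [cite: SilvermanAEC2009, VIII.§2] [cite: GrossLMS1991, §9 Prop. 9.1] -/
theorem exists_zsmul_eq_of_torsionFixing_fixed_root
    (hρ : ∀ n : ℕ, 0 < n → W.HasSurjectiveModNGaloisRep ((2 : ℤ) ^ n))
    (hK : IsImaginaryQuadratic K) (hodd : Odd (NumberField.discr K))
    (hnsq₁ : ¬ IsSquare ((NumberField.discr K : ℚ) * -|W.Δ|)) (hnsq₂ : ¬ IsSquare ((NumberField.discr K : ℚ) * (-(2 * |W.Δ|))))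
    {ℓ₀ : ℕ} [Fact ℓ₀.Prime] (hℓK : (ℓ₀ : ℤ) ∣ NumberField.discr K) (hΔ : ¬ (ℓ₀ : ℤ) ∣ minimalDiscriminantInt W)
    {ξ : galH1Torsion W (2 : ℤ)} (hξ0 : ξ ≠ 0) (hξ4 : ∀ h ∈ torsionFixing W (4 : ℤ), h1Eval W (2 : ℤ) ξ h = 0)
    {v : HeightOneSpectrum (𝓞 ℚ)} (hv : (primesEquiv v : ℕ) = ℓ₀) {𝔓₀ : Ideal (absIntegers (𝓞 ℚ) ℚ)} (h𝔓₀ : 𝔓₀ ∈ v.primesAbove)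
    {F : absoluteGaloisGroup ℚ} (hF : IsArithFrobAt (𝓞 ℚ) F 𝔓₀) (hF2 : F * F ∈ torsionFixing W (2 : ℤ))
    (hval : h1Eval W (2 : ℤ) ξ (F * F) ≠ 0)
    (hfixodd : ∀ R : (W.baseChange K).toAffine.Point, (∀ τ : K ≃ₐ[ℚ] K, τ • R = R) → ∃ m : ℕ, Odd m ∧ (m : ℤ) • R = 0)
    {L : ℕ} (hL : 2 ≤ L) :
    ∀ (M : ℕ), M ≤ L → ∀ (P : (W.baseChange K).toAffine.Point) (Q : geomPoints (W.baseChange K)),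
      (∀ ρ ∈ torsionFixing (W.baseChange K) ((2 ^ L : ℕ) : ℤ), ρ • Q = Q) →
      ((2 ^ M : ℕ) : ℤ) • Q = toGeomPoints (W.baseChange K) P →
      ∃ R : (W.baseChange K).toAffine.Point, ((2 ^ M : ℕ) : ℤ) • R = P := by
  have h2 : Module.finrank ℚ K = 2 := hK.1
  have hsurj : W.HasSurjectiveModNGaloisRep 2 := by simpa using hρ 1 one_pos
  have hℓ2 : ℓ₀ ≠ 2 := by
    rintro rfl
    obtain ⟨k, hk⟩ := hodd
    obtain ⟨j, hj⟩ := hℓK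
    omega
  have h1L : (2 : ℤ) ∣ ((2 ^ L : ℕ) : ℤ) := by
    obtain ⟨j, hj⟩ : ∃ j, L = j + 1 := ⟨L - 1, by omega⟩
    exact ⟨((2 ^ j : ℕ) : ℤ), by rw [hj]; push_cast; ring⟩
  have hL2 : torsionFixing (W.baseChange K) ((2 ^ L : ℕ) : ℤ) ≤ torsionFixing (W.baseChange K) (2 : ℤ) :=
    torsionFixing_le_of_dvd (W.baseChange K) h1L
  intro M
  induction M with
  | zero =>
    intro _ P Q _ _
    exact ⟨P, by simp⟩
  | succ M ih =>
    intro hML P Q hfix hQ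
    have hn0 : ((2 ^ M : ℕ) : ℤ) ≠ 0 := by positivity
    -- `Q₁ := 2^M • Q`, `2 • Q₁ = ι P`, fixed by `Γ_L`
    obtain ⟨Q₁, hQ₁⟩ : ∃ Q₁ : geomPoints (W.baseChange K), Q₁ = ((2 ^ M : ℕ) : ℤ) • Q := ⟨_, rfl⟩
    have h2Q₁ : (2 : ℤ) • Q₁ = toGeomPoints (W.baseChange K) P := by
      rw [hQ₁, smul_smul, ← hQ]
      congr 1
      push_cast
      ring
    have hQ₁fix : ∀ ρ ∈ torsionFixing (W.baseChange K) ((2 ^ L : ℕ) : ℤ), ρ • Q₁ = Q₁ := by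
      intro ρ hρ'
      rw [hQ₁, smul_zsmul_geomPoints, hfix ρ hρ']
    have hQ₁mem : (2 : ℤ) • Q₁ ∈ MulAction.fixedPoints (absoluteGaloisGroup K) (geomPoints (W.baseChange K)) := by
      rw [h2Q₁]; exact toGeomPoints_mem_fixedPoints _ _
    -- its Kummer class dies on `Γ_L`
    have hz : ∀ ρ ∈ torsionFixing (W.baseChange K) ((2 ^ L : ℕ) : ℤ),
        h1Eval (W.baseChange K) (2 : ℤ) (kummerClassTorsion (W.baseChange K) (2 : ℤ) Q₁ hQ₁mem) ρ = 0 := by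
      intro ρ hρ'
      apply Subtype.ext
      rw [coe_h1Eval_kummerClassTorsion (W.baseChange K) (2 : ℤ) Q₁ hQ₁mem (hL2 hρ'), hQ₁fix ρ hρ', sub_self]
      rfl
    rcases eq_zero_or_eq_resTorsion_of_forall_torsionFixing_pow W hρ hK hodd hnsq₁ hnsq₂ hξ0 hξ4 hL hz with h0 | hres
    · -- `κ(Q₁) = 0`: `Q₁ − T` is rational
      obtain ⟨T, hT, hfixT⟩ := (kummerClassTorsion_eq_zero_iff (W.baseChange K) (2 : ℤ) Q₁ hQ₁mem).mp h0
      obtain ⟨R₁, hR₁⟩ := (mem_range_toGeomPoints_iff (W.baseChange K) (Q₁ - T)).mpr hfixT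
      have hT2 : (2 : ℤ) • T = 0 := (mem_geomTorsion_iff _ (2 : ℤ) T).mp hT
      have h2R₁ : (2 : ℤ) • R₁ = P := by
        apply toGeomPoints_injective (W.baseChange K)
        rw [map_zsmul, hR₁, smul_sub, hT2, sub_zero, h2Q₁]
      -- `T' ∈ E[2^(M+1)] ⊆ E[2^L]` with `2^M • T' = T`
      obtain ⟨T', hT'⟩ := (W.baseChange K).zsmul_geomPoints_surjective_of_charZero hn0 T
      have hT'' : ((2 ^ M : ℕ) : ℤ) • T' = T := hT'
      have hT'L : T' ∈ geomTorsion (W.baseChange K) ((2 ^ L : ℕ) : ℤ) := by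
        rw [mem_geomTorsion_iff]
        obtain ⟨j, hj⟩ : ∃ j, L = M + 1 + j := ⟨L - (M + 1), by omega⟩
        have : ((2 ^ L : ℕ) : ℤ) = ((2 ^ j : ℕ) : ℤ) * (2 : ℤ) * ((2 ^ M : ℕ) : ℤ) := by
          rw [hj]; push_cast; ring
        rw [this, mul_smul, mul_smul, hT'', hT2, smul_zero]
      have hT'fix : ∀ ρ ∈ torsionFixing (W.baseChange K) ((2 ^ L : ℕ) : ℤ), ρ • T' = T' := fun ρ hρ' ↦
        congrArg Subtype.val (smul_eq_of_mem_torsionFixing (W.baseChange K) _ hρ' ⟨T', hT'L⟩)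
      -- induction hypothesis for `R₁` and the root `Q − T'`
      obtain ⟨R, hR⟩ := ih (by omega) R₁ (Q - T') (fun ρ hρ' ↦ by rw [smul_sub, hfix ρ hρ', hT'fix ρ hρ'])
        (by rw [smul_sub, hT'', ← hQ₁]; exact hR₁.symm)
      refine ⟨R, ?_⟩
      have : ((2 ^ (M + 1) : ℕ) : ℤ) = (2 : ℤ) * ((2 ^ M : ℕ) : ℤ) := by push_cast; ring
      rw [this, mul_smul, hR, h2R₁]
    · -- `κ(Q₁) = res ξ`: excluded on an (α)-frame
      exact absurd hres (kummerClassTorsion_ne_resTorsion_of_fixed_odd W hsurj h2 hℓ2 hℓK hΔ hξ4 hv h𝔓₀ hF hF2 hval hfixodd P Q₁ h2Q₁)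

/-- ★★ **THE LEAD's `hDesc` BINDER, DISCHARGED ON AN (α)-FRAME** (VERBATIM shape of `PlusDescent.zsmul_kolyvaginClass_one_eq_zero_of_phantom_of_descent`'s
hypothesis, for any `Ph ∈ E(K)` — e.g. the Heegner point `y_K` — any `M ≤ L`, `2 ≤ L`; the LEAD uses `L = M + 2`).  Same frame as
`exists_zsmul_eq_of_torsionFixing_fixed_root`.  **BSD is NOT proved by this; K4Neg is NOT proved.**
[cite: LawsonWuthrich2016, §3, §7.1] [cite: SilvermanAEC2009, VIII.§2] [cite: GrossLMS1991, §9] -/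
theorem hDesc_of_phantom_alive
    (hρ : ∀ n : ℕ, 0 < n → W.HasSurjectiveModNGaloisRep ((2 : ℤ) ^ n))
    (hK : IsImaginaryQuadratic K) (hodd : Odd (NumberField.discr K))
    (hnsq₁ : ¬ IsSquare ((NumberField.discr K : ℚ) * -|W.Δ|)) (hnsq₂ : ¬ IsSquare ((NumberField.discr K : ℚ) * (-(2 * |W.Δ|))))
    {ℓ₀ : ℕ} [Fact ℓ₀.Prime] (hℓK : (ℓ₀ : ℤ) ∣ NumberField.discr K) (hΔ : ¬ (ℓ₀ : ℤ) ∣ minimalDiscriminantInt W)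
    {ξ : galH1Torsion W (2 : ℤ)} (hξ0 : ξ ≠ 0) (hξ4 : ∀ h ∈ torsionFixing W (4 : ℤ), h1Eval W (2 : ℤ) ξ h = 0)
    {v : HeightOneSpectrum (𝓞 ℚ)} (hv : (primesEquiv v : ℕ) = ℓ₀) {𝔓₀ : Ideal (absIntegers (𝓞 ℚ) ℚ)} (h𝔓₀ : 𝔓₀ ∈ v.primesAbove)
    {F : absoluteGaloisGroup ℚ} (hF : IsArithFrobAt (𝓞 ℚ) F 𝔓₀) (hF2 : F * F ∈ torsionFixing W (2 : ℤ))
    (hval : h1Eval W (2 : ℤ) ξ (F * F) ≠ 0)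
    (hfixodd : ∀ R : (W.baseChange K).toAffine.Point, (∀ τ : K ≃ₐ[ℚ] K, τ • R = R) → ∃ m : ℕ, Odd m ∧ (m : ℤ) • R = 0)
    (Ph : (W.baseChange K).toAffine.Point) {M L : ℕ} (hL : 2 ≤ L) (hML : M ≤ L) :
    ∀ (b : ℤ) (Q : geomPoints (W.baseChange K)),
      (∀ ρ ∈ torsionFixing (W.baseChange K) ((2 ^ L : ℕ) : ℤ), ρ • Q = Q) →
      ((2 ^ M : ℕ) : ℤ) • Q = toGeomPoints (W.baseChange K) (b • Ph) →
      ∃ R : (W.baseChange K).toAffine.Point, ((2 ^ M : ℕ) : ℤ) • R = b • Ph :=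
  fun b Q hfix hQ ↦ exists_zsmul_eq_of_torsionFixing_fixed_root W hρ hK hodd hnsq₁ hnsq₂ hℓK hΔ hξ0 hξ4 hv h𝔓₀ hF hF2 hval
    hfixodd hL M hML (b • Ph) Q hfix hQ

/-! ## §5 The odd-torsion hypothesis from «`E(ℚ)` is torsion» -/
omit [W.IsGloballyMinimal] in
/-- **On a rank-`0` curve without rational `2`-torsion, every `Aut(K/ℚ)`-fixed point of `E(K)` is ODD torsion**: it is `ι s₀` for some
`s₀ ∈ E(ℚ)` (Galois descent, gk2-p5 `exists_toGeomPoints_eq_map_absEmbedding`), `s₀` has finite order (`E(ℚ)` torsion — READ IN `E(ℚ̄)`,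
`IsOfFinAddOrder (ι_* s₀)`, the instance-robust form of `…DepthZeroRationalTorsion`), and the order is odd because `E(K)[2] = 0` (`ρ̄_{E,2}` onto,
`K` imaginary quadratic).  [cite: SilvermanAEC2009, VIII.§1] [cite: DokchitserDokchitserMathZ2012, Theorem (1)] -/
theorem forall_fixed_odd_torsion_of_rank_zero
    (hρ : ∀ n : ℕ, 0 < n → W.HasSurjectiveModNGaloisRep ((2 : ℤ) ^ n)) (hK : IsImaginaryQuadratic K)
    (htor : ∀ s₀ : W.toAffine.Point, IsOfFinAddOrder (WeierstrassCurve.toGeomPoints W s₀)) :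
    ∀ R : (W.baseChange K).toAffine.Point, (∀ τ : K ≃ₐ[ℚ] K, τ • R = R) → ∃ m : ℕ, Odd m ∧ (m : ℤ) • R = 0 := by
  have h2 : Module.finrank ℚ K = 2 := hK.1
  haveI : Algebra.IsQuadraticExtension ℚ K := ⟨h2⟩
  haveI : IsGalois ℚ K := inferInstance
  intro R hR
  obtain ⟨s₀, hs₀⟩ := exists_toGeomPoints_eq_map_absEmbedding W hR
  obtain ⟨e, he⟩ : ∃ e : (W.baseChange K).toAffine.Point →+ W.geomPoints,
      e = Affine.Point.map (W' := W) (absEmbedding ℚ K) := ⟨_, rfl⟩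
  have heinj : Function.Injective e := by rw [he]; exact Affine.Point.map_injective (W' := W) _
  have hfinR' : IsOfFinAddOrder (e R) := by
    have h1 := htor s₀
    rw [hs₀] at h1
    rw [he]
    exact h1
  have h2K := forall_two_zsmul_eq_zero_baseChange W hρ hK
  obtain ⟨n, hn, hne⟩ := hfinR'.exists_nsmul_eq_zero
  have hnR : n • R = 0 := heinj (by rw [map_nsmul, map_zero, hne])
  have hRfin : IsOfFinAddOrder R := isOfFinAddOrder_iff_nsmul_eq_zero.mpr ⟨n, hn, hnR⟩
  have hodd : Odd (addOrderOf R) := odd_addOrderOf_of_two_torsionFree hRfin fun k hk ↦ h2K _ hk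
  exact ⟨addOrderOf R, hodd, by rw [natCast_zsmul, addOrderOf_nsmul_eq_zero]⟩

end Frame

end Summit.BirchSwinnertonDyer.BirchSwinnertonDyer.Theorems.GenusExact.PhantomDescentBit

end
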